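import Summits.MatrixMultiplication.MatrixMultiplication.Theses.FidelityWitnesses
import Summits.MatrixMultiplication.MatrixMultiplication.Theorems.SevenEighthsLaw.Negative.SharpConstants
import Literature.Computability.AlgebraicComplexity.BorderRankMatMulTwoHolds

/-!
# Line `stabiliser-capacity-support-law` for crux `FidelityWitnesses.SevenEighthsLaw` (stmt-MatrixMultiplication-4959)

Skeleton (crux-plan, opening round 1, planner-cruxplan-stmt-MatrixMultiplication-4959-stabiliser-capacity--0,
2026-08-16) of idea card `Cruxes/SevenEighthsLaw/Ideas/stabiliser-capacity-support-law.md` (crux-ideate r1,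
ideator 1); triage r1-1 / r1-2 / r1-3: **pass / pass / pass** (sharpenings built in, see the line card
`Lines/stabiliser-capacity-support-law.md`, § Triage answers).

THE CRUX. `SevenEighthsLaw : ∀ S : P2 → P2 → P2 → ℂ, tensorRank S ≤ 6 → ‖∑ S·⟨2,2,2⟩‖² ≤ 7 · ∑ ‖S‖²`
(`P2 = Fin 2 × Fin 2`; slots of `matMulTensor ℂ 2 2 2 a b c`: `a = (κ,ν)` the output form, `b = (κ,μ) ∈ A`,
`c = (μ,ν) ∈ B`; `T := ⟨2,2,2⟩` is the indicator of `a.1 = b.1 ∧ b.2 = c.1 ∧ a.2 = c.2`, eight ones).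
`M(2,6) = 7`: no border-rank-`6` tensor captures more than `7/8` of `⟨2,2,2⟩`.

THE LINE (stabiliser capacity + support law). The complex stabiliser `G_T = {(X,Y,Z)} ≅ GL₂³` of `T`
(`stabAct`: `X` on leg `a.1` and `X⁻ᵀ` on leg `b.1` — the shared index `κ`; `Y` on `b.2`, `Y⁻ᵀ` on `c.1` — index
`μ`; `Z` on `c.2`, `Z⁻ᵀ` on `a.2` — index `ν`) fixes `T`, preserves rank and the closed set
`Sigma6 := closure {rank ≤ 6}`, and leaves the OVERLAP `overlap S = ∑ S·T` invariant (it is transpose-closed),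
while it changes the norm. Hence the crux is a statement about `|ℓ|²/capacity` on the quotient, and
Kempf–Ness theory normalises the unknown approximant instead of certifying an inequality on all of `σ₆`:
* `stub_capacityNormalForm` (Kempf–Ness normal form, compactness): every `S ∈ Sigma6` may be replaced by a
  MINIMAL VECTOR `S₀ ∈ Sigma6` (least norm on its own `G_T`-orbit, `IsMinimal`) with the same overlap and no
  larger norm — so it suffices to prove the law at minimal vectors.
* `stub_balanced_of_minimal` (Kempf–Ness first-order condition): a minimal vector is BALANCED (`IsBalanced`:
  for each shared index the one-leg marginal on the covariant leg equals the transpose of the marginal on the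
  contravariant leg — "Kirchhoff's law around the EPR triangle"; verified on `T`, `T − e`, `T − E_xyz`).
* SUPPORT REGIME, settled by a one-parameter border-rank theorem: a tensor supported on `supp T` is
  `suppTensor w` (`8` weights `w κ μ ν`); if all eight weights are non-zero it is a diagonal `GL₄³`-torus
  translate of `c · Tchi χ` (`T` with the structure constant at `(1,1,1)` replaced by
  `χ = r₀₀r₁₁/(r₀₁r₁₀)`, `r_{κμ} = w κ μ 1 / w κ μ 0`), so membership in `Sigma6` forces `R̲(Tchi χ) ≤ 6`
  (`stub_supportReduction`, torus bookkeeping + Alder–Strassen, both in the tree) — contradicting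
  `stub_parametricSeven : χ ≠ 0 → 7 ≤ algBorderRank (Tchi χ)` (THE FIRST LEMMA of the card: the tree's
  torus-fixed border apolarity proof of `7 ≤ R̲(⟨2,2,2⟩)` run with one `χ`-dependent weight line; this seat's
  exact check `num/parametric_cert.py` shows the tree's `66` peeling certificates `MatMulTwo.certList` stay
  valid VERBATIM for `χ ≠ 0` — same zero pattern, monomial pivots — so the stub is a mechanical adaptation;
  independently confirmed by triage r1-2 F5, `Bad = {0}`, and triage r1-3 at 20 special `χ`). Hence a supported
  element of `Sigma6` has a ZERO weight, and then `|∑ w|² ≤ 7 ∑|w|²` is Cauchy–Schwarz on seven terms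
  (`seven_terms`, PROVED here): the sharp constant `7 = 8 − 1` appears as a count, with equality exactly at
  `T − e` and its torus relatives.
* RESIDUAL REGIME (the open part, typed as the triage asked): `stub_residualLaw` — the law for minimal,
  balanced `S ∈ Sigma6` with some off-support coordinate. For such `S` the off-support torus weights carrying
  mass sum to zero (torus part of balancedness), so the Hilbert–Mumford reduction to the support is exhausted
  and a certificate is needed; the line's format is a CAPACITY CERTIFICATE (a `G_T`-invariant polynomial `p`,
  `cap(S) ≥ (|p(S)|/C_p)^{2/d}`), see the stub's docstring and the line card.
* `SevenEighthsLaw_of` — the kernel-checked composition: rank `≤ 6` ⇒ `S ∈ Sigma6` ⇒ normal form `S₀` ⇒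
  (support regime: contradiction or seven-term Cauchy–Schwarz | residual regime: stub) ⇒
  `‖overlap S‖² = ‖overlap S₀‖² ≤ 7·normSq S₀ ≤ 7·normSq S`.

Disproof.lean (cdisprove v4, `Cruxes/SevenEighthsLaw/Disproof.lean`) and the LANDED negative lane
`Theorems/SevenEighthsLaw/Negative/SharpConstants.lean` (imported above, so every stub is elaborated next to
them): `sevenEighthsLaw_false_without_rank_bound` (H₁ = the rank bound is the whole content) is honoured — H₁
enters exactly twice, as `Sigma6`-membership consumed by `stub_supportReduction` (support regime) and by
`stub_residualLaw` (residual regime); with `7` triads both die (`S = T`: `χ = 1`, `Tchi 1 = T ∈ closure{rank ≤ 7}`,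
ratio `8`), matching `sevenEighthsLaw_false_with_rank_seven`. `sevenEighthsLaw_attained` / `_tight` /
`_not_strengthened` (the constant `7` is attained at the honest rank-6 tensor `T − a₂₂b₂₂c₂₂` and approached
by the Bini-plus-one family): the support regime is sharp exactly there (`seven_terms` is an equality at
`w = 𝟙 − δ_{111}`), the normal form loses nothing (same overlap, norm non-increasing), and no stub claims
`7 − η`. § (d) of the Disproof (diagonal pencil `T_u`, no root `u ≠ 0`) is the numerical shadow of
`stub_parametricSeven`. No stub is an instance of a refuted statement of the negatives index
(`ledger negatives --problem MatrixMultiplication`: STPP designs ×2, level-graded Cohn–Umans, design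
flattening — unrelated).
-/

noncomputable section

namespace Summit.MatrixMultiplication.MatrixMultiplication.Cruxes.SevenEighthsLaw.StabiliserCapacitySupportLaw

open scoped BigOperators ComplexConjugate Matrix
open Literature.Computability.AlgebraicComplexity
open Summit.MatrixMultiplication.MatrixMultiplication.Theses.FidelityWitnesses

set_option linter.unusedVariables false
set_option linter.dupNamespace false

/-! ## Vocabulary -/

/-- A slot of `⟨2,2,2⟩`: index pairs (the tree's `MatMulTwo.P2`). -/
abbrev P2 : Type := Fin 2 × Fin 2

/-- The overlap `ℓ(S) = ∑ S·⟨2,2,2⟩` (the quantity squared on the left of the crux). -/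
def overlap (S : P2 → P2 → P2 → ℂ) : ℂ := ∑ a, ∑ b, ∑ c, S a b c * matMulTensor ℂ 2 2 2 a b c

/-- The squared norm `∑ ‖S_abc‖²` (the right of the crux, without the factor `7`). -/
def normSq (S : P2 → P2 → P2 → ℂ) : ℝ := ∑ a, ∑ b, ∑ c, ‖S a b c‖ ^ 2

/-- `σ̄₆`: the closure (product topology of `ℂ⁶⁴`) of the tensors of rank `≤ 6`; by Alder–Strassen (tree:
`mem_closure_setOf_tensorRank_le_iff alder_secantVariety_eq_setOf_algBorderRank_le_holds`) it is
`{S | algBorderRank S ≤ 6}`. -/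
def Sigma6 : Set (P2 → P2 → P2 → ℂ) := closure {S | tensorRank S ≤ 6}

/-- The tensor supported on `supp ⟨2,2,2⟩` with weights `w κ μ ν` at `a = (κ,ν)`, `b = (κ,μ)`, `c = (μ,ν)`
(`suppTensor 1 = T`; `overlap (suppTensor w) = ∑ w`, `normSq (suppTensor w) = ∑ ‖w‖²`, proved below). -/
def suppTensor (w : Fin 2 → Fin 2 → Fin 2 → ℂ) : P2 → P2 → P2 → ℂ :=
  fun a b c => if a.1 = b.1 ∧ b.2 = c.1 ∧ a.2 = c.2 then w b.1 b.2 c.2 else 0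

/-- `S` is supported on the eight coordinates of `supp ⟨2,2,2⟩` (= the weight-`0` space of the stabiliser
torus). -/
def IsOnSupport (S : P2 → P2 → P2 → ℂ) : Prop := ∃ w : Fin 2 → Fin 2 → Fin 2 → ℂ, S = suppTensor w

/-- `T_χ`: `⟨2,2,2⟩` with its structure constant at `(κ,μ,ν) = (1,1,1)` (the standard term `a₂₂ ⊗ b₂₂ ⊗ c₂₂` of
the Negative lane) replaced by `χ`; `Tchi 1 = T`, `Tchi 0 = T − E` (honest rank `6`,
`SevenEighthsLawNeg.sixS_eq`). For `χ ≠ 1` it is not isomorphic to `T`. -/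
def Tchi (χ : ℂ) : P2 → P2 → P2 → ℂ :=
  suppTensor fun κ μ ν => if κ = 1 ∧ μ = 1 ∧ ν = 1 then χ else 1

/-- The action of the complex STABILISER `G_T ≅ GL₂ × GL₂ × GL₂` of `⟨2,2,2⟩` on tensors: `X` acts on the
shared index `κ` (by `X` on leg `a.1`, by `X⁻ᵀ` on leg `b.1`), `Y` on `μ` (by `Y` on `b.2`, `Y⁻ᵀ` on `c.1`),
`Z` on `ν` (by `Z` on `c.2`, `Z⁻ᵀ` on `a.2`). For invertible `X, Y, Z`: `stabAct X Y Z T = T`,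
`overlap (stabAct X Y Z S) = overlap S`, rank and `Sigma6` are preserved, and
`stabAct X Y Z ∘ stabAct X' Y' Z' = stabAct (XX') (YY') (ZZ')` (all checked numerically in the seat folder,
`num/conventions.py`; `X⁻¹` is `Matrix.inv`, the true inverse when `IsUnit X.det`). In the regrouping of
`ℂ⁶⁴` by shared index, `V ≅ End ℂ²_κ ⊗ End ℂ²_μ ⊗ End ℂ²_ν`, this is simultaneous conjugation, `T = I ⊗ I ⊗ I`
and `overlap = tr ⊗ tr ⊗ tr`. -/
def stabAct (X Y Z : Matrix (Fin 2) (Fin 2) ℂ) (S : P2 → P2 → P2 → ℂ) : P2 → P2 → P2 → ℂ :=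
  fun a b c => ∑ a' : P2, ∑ b' : P2, ∑ c' : P2,
    X a.1 a'.1 * (Z⁻¹) a'.2 a.2 * ((X⁻¹) b'.1 b.1 * Y b.2 b'.2) * ((Y⁻¹) c'.1 c.1 * Z c.2 c'.2) *
      S a' b' c'

/-- `S` is a MINIMAL VECTOR for the stabiliser action: its norm is least on its `G_T`-orbit
(Kempf–Ness; equivalently `cap(S) = normSq S`). -/
def IsMinimal (S : P2 → P2 → P2 → ℂ) : Prop :=
  ∀ X Y Z : Matrix (Fin 2) (Fin 2) ℂ, IsUnit X.det → IsUnit Y.det → IsUnit Z.det →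
    normSq S ≤ normSq (stabAct X Y Z S)

/-- One-leg marginal (reduced Gram matrix) of `S` on leg `a.1` (index `κ`, acted on by `X`). -/
def margA1 (S : P2 → P2 → P2 → ℂ) : Matrix (Fin 2) (Fin 2) ℂ :=
  fun i j => ∑ ν : Fin 2, ∑ b : P2, ∑ c : P2, S (i, ν) b c * conj (S (j, ν) b c)

/-- One-leg marginal of `S` on leg `b.1` (index `κ`, acted on by `X⁻ᵀ`). -/
def margB1 (S : P2 → P2 → P2 → ℂ) : Matrix (Fin 2) (Fin 2) ℂ :=
  fun i j => ∑ a : P2, ∑ μ : Fin 2, ∑ c : P2, S a (i, μ) c * conj (S a (j, μ) c)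

/-- One-leg marginal of `S` on leg `b.2` (index `μ`, acted on by `Y`). -/
def margB2 (S : P2 → P2 → P2 → ℂ) : Matrix (Fin 2) (Fin 2) ℂ :=
  fun i j => ∑ a : P2, ∑ κ : Fin 2, ∑ c : P2, S a (κ, i) c * conj (S a (κ, j) c)

/-- One-leg marginal of `S` on leg `c.1` (index `μ`, acted on by `Y⁻ᵀ`). -/
def margC1 (S : P2 → P2 → P2 → ℂ) : Matrix (Fin 2) (Fin 2) ℂ :=
  fun i j => ∑ a : P2, ∑ b : P2, ∑ ν : Fin 2, S a b (i, ν) * conj (S a b (j, ν))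

/-- One-leg marginal of `S` on leg `c.2` (index `ν`, acted on by `Z`). -/
def margC2 (S : P2 → P2 → P2 → ℂ) : Matrix (Fin 2) (Fin 2) ℂ :=
  fun i j => ∑ a : P2, ∑ b : P2, ∑ μ : Fin 2, S a b (μ, i) * conj (S a b (μ, j))

/-- One-leg marginal of `S` on leg `a.2` (index `ν`, acted on by `Z⁻ᵀ`). -/
def margA2 (S : P2 → P2 → P2 → ℂ) : Matrix (Fin 2) (Fin 2) ℂ :=
  fun i j => ∑ κ : Fin 2, ∑ b : P2, ∑ c : P2, S (κ, i) b c * conj (S (κ, j) b c)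

/-- `S` is BALANCED (Kempf–Ness critical, moment map of `K_T = U(2)³` zero): for each shared index the
marginal on the covariant leg equals the TRANSPOSE of the marginal on the contravariant leg. Derivation:
along `X = exp(tH)` one has `d/dt normSq (stabAct X 1 1 S) = 2 Re tr (H · (margA1 S − (margB1 S)ᵀ))` for every
complex `H` (numerically verified), so the three equations are exactly the first-order conditions at a
minimal vector. `T`, `T − e` (`e` a standard term) and every `T − E_xyz` are balanced; a single OFF-diagonal
unit term is not (it is in the null cone). -/
def IsBalanced (S : P2 → P2 → P2 → ℂ) : Prop :=
  margA1 S = (margB1 S)ᵀ ∧ margB2 S = (margC1 S)ᵀ ∧ margC2 S = (margA2 S)ᵀ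

/-! ## The stubs -/

/-- **Stub 1 — Kempf–Ness normal form (capacity normal form).** Every `S` in `σ̄₆` can be replaced by a
MINIMAL vector `S₀ ∈ σ̄₆` with the same overlap and no larger norm.
Why plausibly true (provable now): let `O := {stabAct X Y Z S | X Y Z invertible}` and minimise the continuous
`normSq` over the compact set `closure O ∩ {S' | normSq S' ≤ normSq S}` (closed and bounded in `ℂ⁶⁴`,
contains `S`; `IsCompact.exists_isMinOn`, `Metric.isCompact_iff_isClosed_bounded` / `ProperSpace`). The
minimiser `S₀` has: `overlap S₀ = overlap S` (`overlap` is constant on `O` — finite-sum bookkeeping with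
`X * X⁻¹ = 1`, `Matrix.mul_nonsing_inv` — hence on `closure O` by continuity); `S₀ ∈ Sigma6` (each `stabAct g`
is linear, hence continuous, and maps triads to triads, so `stabAct g '' {rank ≤ 6} ⊆ {rank ≤ 6}` via
`tensorRank_le_of_eq_sum`, so `O ⊆ Sigma6`, which is closed); `IsMinimal S₀` (for invertible `g`,
`stabAct g S₀ ∈ closure O` by the composition law `stabAct g (stabAct g' S) = stabAct (g g') S`
(`Matrix.mul_inv_rev`) and continuity of `stabAct g`; a strictly smaller norm would contradict minimality).
The tree's `exists_frobSq_minimizer` (KempfNessMinimizer.lean) is the same device for another action.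
Size M. -/
theorem stub_capacityNormalForm :
    ∀ S : P2 → P2 → P2 → ℂ, S ∈ Sigma6 →
      ∃ S₀ : P2 → P2 → P2 → ℂ, S₀ ∈ Sigma6 ∧ IsMinimal S₀ ∧
        overlap S₀ = overlap S ∧ normSq S₀ ≤ normSq S := by
  sorry

/-- **Stub 2 — minimal vectors are balanced (Kempf–Ness first-order condition).**
Why plausibly true (provable now): for a minimal `S` and each factor, `t ↦ normSq (stabAct (exp (tH)) 1 1 S)`
(`H = U diag(θ) Uᴴ` Hermitian; or the rational curve `X = 1 + tH`, `X⁻¹` analytic near `0`) has a minimum at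
`t = 0`, so its derivative `2 Re tr (H (margA1 S − (margB1 S)ᵀ))` vanishes (`IsLocalMin.hasDerivAt_eq_zero`);
the difference is Hermitian (`tr` of both marginals is `normSq S`), and `tr (H D) = 0` for all Hermitian `H`
forces `D = 0`. Identical pattern, already in the tree for a tensor-power action:
`firstOrder_of_frobSq_minimizer` (KempfNessMinimizer.lean: `Matrix.diagonal (exp (s θ))`, unitary
conjugation, `hasDerivAt` of a finite exponential sum). Three factors = three copies of one computation.
Size M. -/
theorem stub_balanced_of_minimal :
    ∀ S : P2 → P2 → P2 → ℂ, IsMinimal S → IsBalanced S := by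
  sorry

/-- **Stub 3 — `ParametricSeven`, THE FIRST LEMMA (hardest stub of the covered regime): `R̲(T_χ) ≥ 7` for
every `χ ≠ 0`.** (`Tchi 0 = T − E` has rank `6`, so `χ ≠ 0` is necessary; `χ = 1` is the tree theorem
`MatMulTwo.seven_le_algBorderRank_matMulTensor_two`.)
Why plausibly true — in fact REDUCED TO BOOKKEEPING by this seat's exact check (`num/parametric_cert.py`,
attached to the item): `annSub (Tchi χ)` (forms on `A × B` killing the four slices
`∑_μ t_{κμν} X_{κμ} ⊗ Y_{μν}`) is the sum of the SAME `12` weight lines as for `T` (tree: `MatMulTwo.wvZ k`,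
degrees `MatMulTwo.wdeg`, grading `deg = 6i − 2j + 2j' + k`), except that line `k = 11`,
`e^{(1,0)(0,1)} − e^{(1,1)(1,1)}`, becomes `χ·e^{(1,0)(0,1)} − e^{(1,1)(1,1)}` (same degree `7`; each
annihilation condition pairs two coordinates of equal degree, so `annSub (Tchi χ)` is graded exactly as
`annSub T`). Every `(210)`/`(120)` product of that line has, at EVERY coordinate, an entry that is a monomial
`c` or `c·χ` (`c ∈ ℤ`) — the `χ`-part (`b = (0,1)` resp. `a = (1,0)`) and the constant part (`b = (1,1)` resp.
`a = (1,1)`) have disjoint supports — so for `χ ≠ 0` the ZERO PATTERN of all `48` product rows is that of `T`,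
and THE TREE'S `66` GAUSSIAN-PEELING CERTIFICATES `MatMulTwo.certList` REMAIN VALID VERBATIM: checked
symbolically for all `66` entries (upper-triangular at the recorded pivots, diagonal entries non-zero
monomials; `55` certificates use line-`11` rows, `121` diagonal pivots carry `χ`), and cross-checked by exact
ranks over `ℚ` at `χ ∈ {1, 2, −1, 3/7, −5/2}` (`0/66` frames pass, min-max rank `35`) and `χ = 0` (`20/66`
pass, as `R(T₀) = 6` demands). Independent confirmations: triage r1-2 F5 (gcd of maximal minors a pure power of
`χ`, `Bad = {0}`), triage r1-3 F5 (`0/66` at 20 special `χ`), Disproof § (d) (u-scan). HENCE THE LEAN ROUTE: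
(i) `χ`-versions of the four `annSub`-structure lemmas (`mem_annSub_matMul_iff`, `projDeg_mem_annSub`,
`exists_wv_eq_smul`, `inPart_wdeg_le` ⇒ `finrank_le_card_weightLines`) with `wvχ 11 := χ • e₉ − e₁₅`;
(ii) `rank_test_ge_chi (hχ : χ ≠ 0)`: same `certList`, `rowFunχ = χ • rowA + rowB` with integer tables
`valA`, `valB` and a `decide +kernel` check "below the diagonal both vanish, on the diagonal exactly one
vanishes", soundness by `Matrix.det_of_upperTriangular` exactly as `MatMulTwo.rank_test_ge`; (iii) the main
proof copied from `seven_le_algBorderRank_matMulTensor_two` (generic ingredients `isApproxDecomposition_pert`,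
`finrank_I21_pert_add_le`/`finrank_I12_pert_add_le`, `limSub_I11_le_annSub`, `map_mul210_limSub_le`,
`finrank_symA_le`/`finrank_symB_le` apply to any tensor of the format; replace `six_le_algBorderRank…` by
padding a shorter approximate decomposition with zero triads). Why it might fail: it cannot modulo (i)–(iii)
being the routine they appear to be; the only conceptual input beyond the tree — "same zero pattern" — is
checked. Free fallback never needed: `{χ | R̲(T_χ) ≤ 6}` is Zariski-closed, contains `0`, misses `1`, hence
finite. Size L (mechanical adaptation of `BorderRankMatMulTwo{Weights,Candidates,Cert,Apolarity}`). -/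
theorem stub_parametricSeven :
    ∀ χ : ℂ, χ ≠ 0 → 7 ≤ algBorderRank (Tchi χ) := by
  sorry

/-- **Stub 4 — support reduction (diagonal torus orbits on the support + Alder–Strassen).** A tensor
supported on `supp T` with ALL EIGHT weights non-zero that lies in `σ̄₆` forces `R̲(T_χ) ≤ 6` for some
`χ ≠ 0` — which Stub 3 forbids; so every supported element of `σ̄₆` has a zero weight.
Why plausibly true (provable now): (i) ORBIT LEMMA (`SupportTorusOrbits` of the card, made explicit): with
`r κ μ := w κ μ 1 / w κ μ 0` put `χ := r 0 0 * r 1 1 / (r 0 1 * r 1 0) ≠ 0`, `lb (κ,μ) := w κ μ 0`,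
`la (0,ν) := 1`, `la (1,0) := 1`, `la (1,1) := r 1 0 / r 0 0`, `lc (μ,0) := 1`, `lc (0,1) := r 0 0`,
`lc (1,1) := r 0 1`; then `suppTensor w a b c = la a * lb b * lc c * Tchi χ a b c` for all `a b c` (64 cases,
`field_simp`; checked numerically in `num/conventions.py`) — the `8 × 12` character matrix of the diagonal torus
`(ℂˣ)⁴ × (ℂˣ)⁴ × (ℂˣ)⁴ ⊂ GL₄³` on `(ℂˣ)⁸` is the edge–face incidence of the octahedron, rank `7`, its cokernel
the character `∏ w^{(−1)^{κ+μ+ν}}` (triage r1-1/2 re-verified). (ii) The diagonal scaling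
`D S a b c := (la a)⁻¹ (lb b)⁻¹ (lc c)⁻¹ S a b c` is a linear homeomorphism of `ℂ⁶⁴` mapping triads to triads
(`triad (la⁻¹ • w) …`), so `D '' {rank ≤ 6} ⊆ {rank ≤ 6}` (`tensorRank_le_of_eq_sum` on an optimal
decomposition, or `tensorRank_map`-style bookkeeping) and `D '' closure ⊆ closure (D '' ·)`
(`image_closure_subset_closure_image`), whence `Tchi χ = D (suppTensor w) ∈ Sigma6`. (iii) Alder–Strassen,
Euclidean form, PROVED in the tree: `(mem_closure_setOf_tensorRank_le_iff
alder_secantVariety_eq_setOf_algBorderRank_le_holds 6 _).1 : Tchi χ ∈ closure {rank ≤ 6} → algBorderRank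
(Tchi χ) ≤ 6`. Size M. -/
theorem stub_supportReduction :
    ∀ w : Fin 2 → Fin 2 → Fin 2 → ℂ, (∀ κ μ ν, w κ μ ν ≠ 0) → suppTensor w ∈ Sigma6 →
      ∃ χ : ℂ, χ ≠ 0 ∧ algBorderRank (Tchi χ) ≤ 6 := by
  sorry

/-- **Stub 5 — the RESIDUAL LAW (the open part of the line, typed as triage r1-1/2/3 asked).** The crux at
a minimal (hence balanced) `S ∈ σ̄₆` that has mass OFF the support of `T`.
What the hypotheses give (all derivable, none assumed beyond the stubs above): (1) TORUS KIRCHHOFF LAW — with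
`wt(a,b,c) := (a.1 − b.1, b.2 − c.1, c.2 − a.2) ∈ {−1,0,1}³` (the stabiliser-torus weight; `0` exactly on
`supp T`), balancedness contains `∑_{abc} ‖S_abc‖² · wt(a,b,c) = 0`, so the off-support weights carrying mass
positively span `0`: no one-parameter subgroup of the torus shrinks `S` onto its supported part (the
Hilbert–Mumford reduction of the card, `OneSidedReduction`, is exhausted here — for NON-balanced one-sided `S`
it remains a valid lemma: the torus limit lies in `Sigma6`, keeps `overlap`, lowers `normSq`). (2) FREE GAUGE —
the hypothesis set is `K_T = U(2)³`-invariant (unitary `X, Y, Z` preserve `Sigma6`, `overlap`, `normSq`,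
minimality), so WLOG `margA1 S`, `margB2 S`, `margC2 S` are real diagonal: three probability vectors after
`normSq S = 7`. (3) CAPACITY FORM — minimality says `normSq S = cap(S) := inf_g normSq (g • S)`, so the goal is
`|ℓ(S)|² ≤ 7·cap(S)`, and every holomorphic `G_T`-invariant `p` of degree `d` with sphere maximum `C_p`
certifies `cap(S) ≥ (‖p S‖/C_p)^{2/d}` for free; the invariant ring of `GL₂³` by conjugation on
`End ℂ² ⊗ End ℂ² ⊗ End ℂ²` is explicit (degree 1: `ℓ` alone; degree 2: the `8` products of `tr(·)tr(·)` /
`tr(··)` per factor; …), and a sharp certificate must peak on the `K_T`-orbit of `T − e` (minimal, balanced,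
`cap = 7`, `ℓ = 7`): the INTENDED attack is `‖p S‖^{2/d} ≥ C_p^{2/d} ‖ℓ S‖²/7` on `Sigma6` for a low-degree
invariant `p`, positivity now in the `G_T`-transverse directions only (invariants are constant along the
non-compact orbit directions that defeat SOS in triad coordinates). (4) SCHUR REMARK — in the regrouped
picture `S ∈ End(ℂ⁸)`, `ℓ = tr`, and `|tr S|² ≤ rank(S)·‖S‖²`, so the law holds outright whenever the
regrouped operator is singular with rank `≤ 7`, with equality iff `S ∝ I − P`, `P` a rank-one product
projector — exactly the maximiser family `T − E_xyz` of the Disproof; the residual difficulty sits at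
regrouped-invertible `S ∈ σ̄₆`. (5) EQUALITY DATA every certificate must respect (Disproof § (c), triage F1–F3):
the orbit `T − E_xyz` (value `7`, honest rank `6`), the Bini-plus-one line `7 − 28/(7m²+4)` approaching it
from below, Terracini rank `57`, `V₆₀`. Numerics: 1030 descent runs, 160 exact-elimination ascents, cone
feasibility at `7.02` infeasible — never above `7`.
Why it might fail: it is as true as the crux (it IS the crux on a `K_T`-saturated comeagre set modulo the free
normalisation — coverage of the settled regime is measure-zero, triage doubt recorded); what can fail is the
certificate format: no low-degree invariant `p` peaking exactly on `K_T·(T − e)`. Size XL. -/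
theorem stub_residualLaw :
    ∀ S : P2 → P2 → P2 → ℂ, S ∈ Sigma6 → IsMinimal S → IsBalanced S → ¬ IsOnSupport S →
      ‖overlap S‖ ^ 2 ≤ 7 * normSq S := by
  sorry

/-! ## Proved glue: the support tensor and Cauchy–Schwarz on seven terms -/

/-- `overlap (suppTensor w) = ∑ w`. -/
theorem overlap_suppTensor (w : Fin 2 → Fin 2 → Fin 2 → ℂ) :
    overlap (suppTensor w) = ∑ κ, ∑ μ, ∑ ν, w κ μ ν := by
  simp only [overlap, suppTensor, matMulTensor, Fintype.sum_prod_type, Fin.sum_univ_two, Fin.isValue]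
  simp
  ring

/-- `normSq (suppTensor w) = ∑ ‖w‖²`. -/
theorem normSq_suppTensor (w : Fin 2 → Fin 2 → Fin 2 → ℂ) :
    normSq (suppTensor w) = ∑ κ, ∑ μ, ∑ ν, ‖w κ μ ν‖ ^ 2 := by
  simp only [normSq, suppTensor, Fintype.sum_prod_type, Fin.sum_univ_two, Fin.isValue]
  simp
  ring

/-- Cauchy–Schwarz: `‖∑_{i ∈ s} f i‖² ≤ |s| · ∑_{i ∈ s} ‖f i‖²`. -/
theorem norm_sum_sq_le_card_mul {ι : Type*} (s : Finset ι) (f : ι → ℂ) :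
    ‖∑ i ∈ s, f i‖ ^ 2 ≤ s.card * ∑ i ∈ s, ‖f i‖ ^ 2 :=
  calc ‖∑ i ∈ s, f i‖ ^ 2 ≤ (∑ i ∈ s, ‖f i‖) ^ 2 :=
        pow_le_pow_left₀ (norm_nonneg _) (norm_sum_le s f) 2
    _ ≤ s.card * ∑ i ∈ s, ‖f i‖ ^ 2 := sq_sum_le_card_mul_sum_sq

/-- **Seven terms.** If one of the eight weights vanishes, `|∑ w|² ≤ 7 ∑ |w|²` — the sharp constant of the
crux as a count of coordinates (equality at `w = 𝟙 − δ`, i.e. at `T − e`). -/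
theorem seven_terms (w : Fin 2 → Fin 2 → Fin 2 → ℂ) (h : ∃ κ μ ν, w κ μ ν = 0) :
    ‖∑ κ, ∑ μ, ∑ ν, w κ μ ν‖ ^ 2 ≤ 7 * ∑ κ, ∑ μ, ∑ ν, ‖w κ μ ν‖ ^ 2 := by
  classical
  obtain ⟨κ₀, μ₀, ν₀, h0⟩ := h
  set f : Fin 2 × Fin 2 × Fin 2 → ℂ := fun p => w p.1 p.2.1 p.2.2 with hf
  have h1 : (∑ κ, ∑ μ, ∑ ν, w κ μ ν) = ∑ p, f p := by
    simp only [hf, Fintype.sum_prod_type]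
  have h2 : (∑ κ, ∑ μ, ∑ ν, ‖w κ μ ν‖ ^ 2) = ∑ p, ‖f p‖ ^ 2 := by
    simp only [hf, Fintype.sum_prod_type]
  rw [h1, h2]
  set s : Finset (Fin 2 × Fin 2 × Fin 2) := Finset.univ.erase (κ₀, μ₀, ν₀) with hs
  have hf0 : f (κ₀, μ₀, ν₀) = 0 := h0
  have h3 : ∑ p, f p = ∑ p ∈ s, f p := (Finset.sum_erase Finset.univ hf0).symm
  have h4 : ∑ p, ‖f p‖ ^ 2 = ∑ p ∈ s, ‖f p‖ ^ 2 :=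
    (Finset.sum_erase Finset.univ (f := fun p => ‖f p‖ ^ 2) (by rw [hf0]; simp)).symm
  have hcard : s.card = 7 := by
    rw [hs, Finset.card_erase_of_mem (Finset.mem_univ _), Finset.card_univ]
    simp [Fintype.card_prod, Fintype.card_fin]
  rw [h3, h4]
  have key := norm_sum_sq_le_card_mul s f
  rw [hcard] at key
  exact_mod_cast key

/-! ## The composition (kernel-checked, no `sorry` of its own) -/

/-- **`SevenEighthsLaw` from the five stubs.** A rank-`≤ 6` tensor `S` lies in `σ̄₆`; replace it by its
Kempf–Ness normal form `S₀` (Stub 1: same overlap, norm no larger, minimal), which is balanced (Stub 2). If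
`S₀` is supported on `supp T` with all eight weights non-zero, Stub 4 yields `χ ≠ 0` with `R̲(T_χ) ≤ 6`,
contradicting Stub 3; if one weight vanishes, the law at `S₀` is Cauchy–Schwarz on seven terms; otherwise it
is the residual law (Stub 5). Finally `‖overlap S‖² = ‖overlap S₀‖² ≤ 7·normSq S₀ ≤ 7·normSq S`. -/
theorem SevenEighthsLaw_of : SevenEighthsLaw := by
  unfold Summit.MatrixMultiplication.MatrixMultiplication.Theses.FidelityWitnesses.SevenEighthsLaw
  intro S hS
  have hS6 : S ∈ Sigma6 :=
    subset_closure (show S ∈ {S' : P2 → P2 → P2 → ℂ | tensorRank S' ≤ 6} from hS)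
  obtain ⟨S₀, hS₀6, hmin, hov, hnorm⟩ := stub_capacityNormalForm S hS6
  have hbal : IsBalanced S₀ := stub_balanced_of_minimal S₀ hmin
  -- the law at the normal form
  have hlaw : ‖overlap S₀‖ ^ 2 ≤ 7 * normSq S₀ := by
    by_cases hsupp : IsOnSupport S₀
    · obtain ⟨w, rfl⟩ := hsupp
      by_cases hfull : ∀ κ μ ν, w κ μ ν ≠ 0
      · -- all eight weights non-zero: border rank of `T_χ` would drop to `6`
        exfalso
        obtain ⟨χ, hχ, hle⟩ := stub_supportReduction w hfull hS₀6
        have h7 := stub_parametricSeven χ hχ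
        omega
      · -- a zero weight: Cauchy–Schwarz on seven terms
        push Not at hfull
        rw [overlap_suppTensor, normSq_suppTensor]
        exact seven_terms w hfull
    · exact stub_residualLaw S₀ hS₀6 hmin hbal hsupp
  -- transfer back to `S`: same overlap, norm no larger
  show ‖overlap S‖ ^ 2 ≤ 7 * normSq S
  rw [← hov]
  calc ‖overlap S₀‖ ^ 2 ≤ 7 * normSq S₀ := hlaw
    _ ≤ 7 * normSq S := by gcongr

end Summit.MatrixMultiplication.MatrixMultiplication.Cruxes.SevenEighthsLaw.StabiliserCapacitySupportLaw

end
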